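import Summits.Ventures.PercRepro.RankLevelSetBiIndepLR

/-! # RankLevelSetIndepCD — THE CONTRACTION/DELETION LIKELIHOOD-RATIO ORDER (CD) OF THE INDEPENDENCE PROFILES,
AND ITS FIBRE DECOMPOSITION INTO NEAR-MIDDLE (★★) INEQUALITIES (night-1 g27; dossier §39.5–39.6)

For a finite matroid `M` and an element `e` put `x_k = contractCount M e k = #{T ⊆ E ∖ {e} : #T = k, T ∪ {e} independent}`
(the independence profile of `M / e`) and `y_k = deleteCount M e k = #{T ⊆ E ∖ {e} : #T = k, T independent}` (that of
`M ∖ e`). **(CD)** (`IndepCD M`, a `Prop`, NOT asserted): `x_{k+1} · y_k ≤ x_k · y_{k+1}` for every `k` — the profile of the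
contraction is below that of the deletion in the likelihood-ratio order, i.e. the fraction of independent `k`-sets of
`M ∖ e` whose closure contains `e` is nondecreasing in `k`. CENSUS (night-1 g27, own exact code): all 383,172 matroids on
9 elements (3,446,350 `(M, e)` instances), all `n ≤ 8`, every theta graph with ≤ 16 edges, random GF(2/3/5) matroids on
10 … 13 elements and series extensions to 13 elements — 0 failures; the weighted form (positive weights on the
elements) is census-clean too, and the weighted difference `x_k y_{k+1} − x_{k+1} y_k` has no negative coefficient on
every matroid with ≤ 7 elements. THE FIBRES: grouping the pairs `(A, B)` counted by `x_{k+1} y_k` and `x_k y_{k+1}` by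
`(U, W) = (A ∪ B, A ∩ B)` and writing `V = U ∖ W`, `A = W ∪ A₀`, `B = W ∪ (V ∖ A₀)`, the fibre over `(U, W)` counts the
`A₀ ⊆ V` (`#V = 2j + 1`, `j = k − #W`) with `W ∪ A₀ ∪ {e}` and `W ∪ (V ∖ A₀)` independent, of size `j + 1` on the left
and `j` on the right — exactly the two sides of (★★) at the last level below the middle for the minor
`(M / W) | (V ∪ {e})` at `e` (`RelPerElemMid M`, stated here directly in `M`; a `Prop`, NOT asserted). So:
**`indepCD_of_relPerElemMid : RelPerElemMid M → IndepCD M`** — (★★) for the minors of `M` implies (CD) for `M`; (CD)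
sits BELOW the cell's conjecture (★★) in the hierarchy. The proof is the fibrewise comparison (`Finset.card_product`,
`Finset.card_eq_sum_card_fiberwise`, a bijection of each fibre with the `A₀`-sets). Every declaration has a docstring;
imports: the cell's own modules and Mathlib only. Axioms: standard. -/

namespace PercRepro

open Set Matroid Finset

variable {α : Type} (M : Matroid α) [M.Finite]

omit [M.Finite] in
/-- `x_k = #{T ⊆ E ∖ {e} : #T = k, T ∪ {e} independent}`: the independence profile of the contraction `M / e`. -/
noncomputable def contractCount (e : α) (k : ℕ) : ℕ :=
  {T : Set α | T ⊆ M.E \ {e} ∧ T.ncard = k ∧ M.Indep (insert e T)}.ncard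

omit [M.Finite] in
/-- `y_k = #{T ⊆ E ∖ {e} : #T = k, T independent}`: the independence profile of the deletion `M ∖ e`. -/
noncomputable def deleteCount (e : α) (k : ℕ) : ℕ :=
  {T : Set α | T ⊆ M.E \ {e} ∧ T.ncard = k ∧ M.Indep T}.ncard

omit [M.Finite] in
/-- **(CD)** (a `Prop`, NOT asserted): `x_{k+1} · y_k ≤ x_k · y_{k+1}` for every `e ∈ E` and every `k`. -/
def IndepCD : Prop :=
  ∀ e ∈ M.E, ∀ k : ℕ, contractCount M e (k + 1) * deleteCount M e k ≤ contractCount M e k * deleteCount M e (k + 1)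

omit [M.Finite] in
/-- The `A₀`-sets of a fibre: `A₀ ⊆ V` with `#A₀ = m`, `W ∪ A₀ ∪ {e}` independent and `W ∪ (V ∖ A₀)` independent. -/
def fibreSets (e : α) (W V : Set α) (m : ℕ) : Set (Set α) :=
  {A₀ : Set α | A₀ ⊆ V ∧ A₀.ncard = m ∧ M.Indep (insert e (W ∪ A₀)) ∧ M.Indep (W ∪ (V \ A₀))}

omit [M.Finite] in
/-- **The relative near-middle (★★)** (a `Prop`, NOT asserted): for `e ∈ E`, disjoint `W, V ⊆ E ∖ {e}` with `#V = 2j + 1`,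
`#{A₀ ⊆ V : #A₀ = j + 1, W ∪ A₀ ∪ {e} and W ∪ (V ∖ A₀) independent} ≤ #{A₀ ⊆ V : #A₀ = j, the same}` — this is
(★★) at the last level below the middle for the minor `(M / W) | (V ∪ {e})` at `e`, written in `M`. -/
def RelPerElemMid : Prop :=
  ∀ e ∈ M.E, ∀ W V : Set α, W ⊆ M.E \ {e} → V ⊆ M.E \ {e} → Disjoint W V → ∀ j : ℕ, V.ncard = 2 * j + 1 →
    (fibreSets M e W V (j + 1)).ncard ≤ (fibreSets M e W V j).ncard

/-- **Counting subsets of a finite set as a `Finset`**: `#{T ⊆ ↑s : P T} = #(s.powerset.filter (P ∘ ↑))`. -/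
lemma ncard_subsets_eq_card_filter (s : Finset α) (P : Set α → Prop) [DecidablePred P] :
    {T : Set α | T ⊆ ↑s ∧ P T}.ncard = (s.powerset.filter (fun T : Finset α => P ↑T)).card := by
  classical
  have himage : {T : Set α | T ⊆ ↑s ∧ P T} =
      (fun T : Finset α => (↑T : Set α)) '' ↑(s.powerset.filter (fun T : Finset α => P ↑T)) := by
    ext T
    simp only [Set.mem_setOf_eq, Set.mem_image, Finset.coe_filter, Finset.mem_powerset]
    constructor
    · rintro ⟨hTs, hP⟩
      have hfin : T.Finite := s.finite_toSet.subset hTs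
      refine ⟨hfin.toFinset, ⟨?_, ?_⟩, hfin.coe_toFinset⟩
      · intro x hx
        rw [hfin.mem_toFinset] at hx
        exact_mod_cast hTs hx
      · rw [hfin.coe_toFinset]; exact hP
    · rintro ⟨F, ⟨hFs, hP⟩, rfl⟩
      exact ⟨Finset.coe_subset.mpr hFs, hP⟩
  rw [himage, Set.ncard_image_of_injective _ Finset.coe_injective, Set.ncard_coe_finset]

section Finsets

variable [DecidableEq α]

omit [M.Finite] in
open Classical in
/-- The `Finset` of the `m`-subsets `T` of `s` with `T ∪ {e}` independent. -/
noncomputable def contractFinset (s : Finset α) (e : α) (m : ℕ) : Finset (Finset α) :=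
  s.powerset.filter (fun T : Finset α => T.card = m ∧ M.Indep (insert e ↑T))

omit [M.Finite] in
open Classical in
/-- The `Finset` of the independent `m`-subsets `T` of `s`. -/
noncomputable def deleteFinset (s : Finset α) (m : ℕ) : Finset (Finset α) :=
  s.powerset.filter (fun T : Finset α => T.card = m ∧ M.Indep ↑T)

omit [M.Finite] in
open Classical in
/-- The fibre sets over a `Finset` ground set, as a `Finset` of `Finset`s. -/
noncomputable def fibreFinset (e : α) (W V : Finset α) (m : ℕ) : Finset (Finset α) :=
  V.powerset.filter (fun A₀ : Finset α => A₀.card = m ∧ M.Indep (insert e ↑(W ∪ A₀)) ∧ M.Indep ↑(W ∪ (V \ A₀)))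

omit [M.Finite] [DecidableEq α] in
open Classical in
/-- `x_m` as a `Finset` count, over the ground set `s = E ∖ {e}`. -/
lemma contractCount_eq_card (e : α) (s : Finset α) (hs : (↑s : Set α) = M.E \ {e}) (m : ℕ) :
    contractCount M e m = (contractFinset M s e m).card := by
  unfold contractCount contractFinset
  rw [← hs, ncard_subsets_eq_card_filter s (fun T : Set α => T.ncard = m ∧ M.Indep (insert e T))]
  refine congrArg Finset.card ?_
  ext T
  simp only [Finset.mem_filter, Finset.mem_powerset, Set.ncard_coe_finset]

omit [M.Finite] [DecidableEq α] in
open Classical in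
/-- `y_m` as a `Finset` count, over the ground set `s = E ∖ {e}`. -/
lemma deleteCount_eq_card (e : α) (s : Finset α) (hs : (↑s : Set α) = M.E \ {e}) (m : ℕ) :
    deleteCount M e m = (deleteFinset M s m).card := by
  unfold deleteCount deleteFinset
  rw [← hs, ncard_subsets_eq_card_filter s (fun T : Set α => T.ncard = m ∧ M.Indep T)]
  refine congrArg Finset.card ?_
  ext T
  simp only [Finset.mem_filter, Finset.mem_powerset, Set.ncard_coe_finset]

omit [M.Finite] in
open Classical in
/-- The fibre sets as a `Finset` count. -/
lemma ncard_fibreSets_eq (e : α) (W V : Finset α) (m : ℕ) :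
    (fibreSets M e ↑W ↑V m).ncard = (fibreFinset M e W V m).card := by
  unfold fibreSets fibreFinset
  rw [ncard_subsets_eq_card_filter V
    (fun A₀ : Set α => A₀.ncard = m ∧ M.Indep (insert e (↑W ∪ A₀)) ∧ M.Indep (↑W ∪ (↑V \ A₀)))]
  refine congrArg Finset.card ?_
  ext A₀
  simp only [Finset.mem_filter, Finset.mem_powerset, Set.ncard_coe_finset, Finset.coe_union, Finset.coe_sdiff]

omit [M.Finite] in
/-- Set algebra of a fibre: for `A ∪ B = U` and `A ∩ B = W`, `W ∪ ((U ∖ W) ∖ (A ∖ W)) = B`. -/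
lemma fibre_second_eq {A B U W : Finset α} (hU : A ∪ B = U) (hW : A ∩ B = W) :
    W ∪ ((U \ W) \ (A \ W)) = B := by
  subst hU hW
  ext x
  simp only [Finset.mem_union, Finset.mem_sdiff, Finset.mem_inter, not_and]
  tauto

omit [M.Finite] in
/-- Set algebra of a fibre: for `A₀ ⊆ U ∖ W` and `W ⊆ U`, `(W ∪ A₀) ∪ (W ∪ ((U ∖ W) ∖ A₀)) = U`. -/
lemma fibre_union_eq {A₀ U W : Finset α} (hWU : W ⊆ U) (hA₀ : A₀ ⊆ U \ W) :
    (W ∪ A₀) ∪ (W ∪ ((U \ W) \ A₀)) = U := by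
  ext x
  simp only [Finset.mem_union, Finset.mem_sdiff]
  have h1 : x ∈ A₀ → x ∈ U ∧ x ∉ W := fun hx => Finset.mem_sdiff.mp (hA₀ hx)
  have h2 : x ∈ W → x ∈ U := fun hx => hWU hx
  tauto

omit [M.Finite] in
/-- Set algebra of a fibre: for `A₀ ⊆ U ∖ W`, `(W ∪ A₀) ∩ (W ∪ ((U ∖ W) ∖ A₀)) = W`. -/
lemma fibre_inter_eq {A₀ U W : Finset α} (hA₀ : A₀ ⊆ U \ W) :
    (W ∪ A₀) ∩ (W ∪ ((U \ W) \ A₀)) = W := by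
  ext x
  simp only [Finset.mem_inter, Finset.mem_union, Finset.mem_sdiff]
  have h1 : x ∈ A₀ → x ∈ U ∧ x ∉ W := fun hx => Finset.mem_sdiff.mp (hA₀ hx)
  tauto

omit [M.Finite] in
open Classical in
/-- **The fibre over `(U, W)` is a set of `A₀`'s**: the pairs `(A, B)` with `A` an `m`-set of `contractFinset`, `B` an
`m'`-set of `deleteFinset`, `A ∪ B = U`, `A ∩ B = W`, correspond by `A ↦ A ∖ W` to the `A₀ ⊆ U ∖ W` of `fibreSets`
with `#A₀ = m − #W` (and `#(U ∖ W) − #A₀ = m' − #W`). -/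
lemma fibre_card_eq (e : α) (s U W : Finset α) (m m' m₀ : ℕ) (hm : m = W.card + m₀)
    (hm' : m' = W.card + ((U \ W).card - m₀)) (hWU : W ⊆ U) (hUs : U ⊆ s) :
    ((contractFinset M s e m ×ˢ deleteFinset M s m').filter
      (fun p : Finset α × Finset α => (p.1 ∪ p.2, p.1 ∩ p.2) = (U, W))).card =
      (fibreSets M e ↑W ↑(U \ W) m₀).ncard := by
  rw [ncard_fibreSets_eq]
  have hWs : W ⊆ s := hWU.trans hUs
  have hVs : U \ W ⊆ s := Finset.sdiff_subset.trans hUs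
  refine Finset.card_nbij' (fun p => p.1 \ W) (fun A₀ => (W ∪ A₀, W ∪ ((U \ W) \ A₀))) ?_ ?_ ?_ ?_
  · rintro ⟨A, B⟩ hp
    rw [Finset.mem_coe, Finset.mem_filter, Finset.mem_product] at hp
    obtain ⟨⟨hA, hB⟩, hf⟩ := hp
    simp only [contractFinset, deleteFinset, Finset.mem_filter, Finset.mem_powerset] at hA hB
    simp only [Prod.mk.injEq] at hf
    obtain ⟨hU, hW⟩ := hf
    have hWA : W ⊆ A := by rw [← hW]; exact Finset.inter_subset_left
    have hAU : A ⊆ U := by rw [← hU]; exact Finset.subset_union_left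
    have hAeq : W ∪ (A \ W) = A := Finset.union_sdiff_of_subset hWA
    have hBeq : W ∪ ((U \ W) \ (A \ W)) = B := fibre_second_eq hU hW
    unfold fibreFinset
    rw [Finset.mem_coe, Finset.mem_filter, Finset.mem_powerset]
    refine ⟨Finset.sdiff_subset_sdiff hAU le_rfl, ?_, ?_, ?_⟩
    · rw [Finset.card_sdiff, Finset.inter_eq_left.mpr hWA, hA.2.1]; omega
    · rw [hAeq]; exact hA.2.2
    · rw [hBeq]; exact hB.2.2
  · intro A₀ hA₀
    unfold fibreFinset at hA₀
    rw [Finset.mem_coe, Finset.mem_filter, Finset.mem_powerset] at hA₀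
    obtain ⟨hA₀V, hA₀card, hind₁, hind₂⟩ := hA₀
    have hdisj₀ : Disjoint W A₀ := by
      refine Finset.disjoint_left.mpr (fun x hxW hxA => ?_)
      exact (Finset.mem_sdiff.mp (hA₀V hxA)).2 hxW
    have hdisj₁ : Disjoint W ((U \ W) \ A₀) := by
      refine Finset.disjoint_left.mpr (fun x hxW hx => ?_)
      exact (Finset.mem_sdiff.mp (Finset.mem_sdiff.mp hx).1).2 hxW
    rw [Finset.mem_coe, Finset.mem_filter, Finset.mem_product]
    refine ⟨⟨?_, ?_⟩, ?_⟩
    · unfold contractFinset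
      rw [Finset.mem_filter, Finset.mem_powerset]
      refine ⟨Finset.union_subset hWs (hA₀V.trans hVs), ?_, hind₁⟩
      rw [Finset.card_union_of_disjoint hdisj₀, hA₀card, hm]
    · unfold deleteFinset
      rw [Finset.mem_filter, Finset.mem_powerset]
      refine ⟨Finset.union_subset hWs (Finset.sdiff_subset.trans hVs), ?_, hind₂⟩
      rw [Finset.card_union_of_disjoint hdisj₁, Finset.card_sdiff, Finset.inter_eq_left.mpr hA₀V, hA₀card, hm']
    · simp only [Prod.mk.injEq]
      exact ⟨fibre_union_eq hWU hA₀V, fibre_inter_eq hA₀V⟩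
  · rintro ⟨A, B⟩ hp
    rw [Finset.mem_coe, Finset.mem_filter, Finset.mem_product] at hp
    obtain ⟨-, hf⟩ := hp
    simp only [Prod.mk.injEq] at hf
    obtain ⟨hU, hW⟩ := hf
    have hWA : W ⊆ A := by rw [← hW]; exact Finset.inter_subset_left
    have hAeq : W ∪ (A \ W) = A := Finset.union_sdiff_of_subset hWA
    have hBeq : W ∪ ((U \ W) \ (A \ W)) = B := fibre_second_eq hU hW
    simp only [hAeq, hBeq]
  · intro A₀ hA₀
    unfold fibreFinset at hA₀
    rw [Finset.mem_coe, Finset.mem_filter, Finset.mem_powerset] at hA₀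
    have hdisj₀ : Disjoint W A₀ := by
      refine Finset.disjoint_left.mpr (fun x hxW hxA => ?_)
      exact (Finset.mem_sdiff.mp (hA₀.1 hxA)).2 hxW
    simp only
    rw [Finset.union_sdiff_cancel_left hdisj₀]

end Finsets

/-- **(★★) FOR THE MINORS IMPLIES (CD)**: `RelPerElemMid M → IndepCD M`. Group the pairs `(A, B)` counted by
`x_{k+1} · y_k` and by `x_k · y_{k+1}` by `(A ∪ B, A ∩ B)`; over each `(U, W)` the two fibres are the two sides of the
relative near-middle inequality for `W` and `V = U ∖ W` (`#V = 2j + 1`, `j = k − #W`). -/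
theorem indepCD_of_relPerElemMid (h : RelPerElemMid M) : IndepCD M := by
  classical
  intro e he k
  set s : Finset α := M.ground_finite.toFinset.erase e with hs
  have hs_coe : (↑s : Set α) = M.E \ {e} := by
    ext x
    simp only [hs, Finset.coe_erase, M.ground_finite.coe_toFinset]
  rw [contractCount_eq_card M e s hs_coe, contractCount_eq_card M e s hs_coe, deleteCount_eq_card M e s hs_coe,
    deleteCount_eq_card M e s hs_coe, ← Finset.card_product, ← Finset.card_product]
  set f : Finset α × Finset α → Finset α × Finset α := fun p => (p.1 ∪ p.2, p.1 ∩ p.2) with hfdef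
  set t : Finset (Finset α × Finset α) := s.powerset ×ˢ s.powerset with htdef
  have hmem : ∀ {m m' : ℕ} (p : Finset α × Finset α), p ∈ contractFinset M s e m ×ˢ deleteFinset M s m' →
      f p ∈ t := by
    intro m m' p hp
    rw [Finset.mem_product] at hp
    obtain ⟨hA, hB⟩ := hp
    simp only [contractFinset, deleteFinset, Finset.mem_filter, Finset.mem_powerset] at hA hB
    simp only [htdef, hfdef, Finset.mem_product, Finset.mem_powerset]
    exact ⟨Finset.union_subset hA.1 hB.1, (Finset.inter_subset_left).trans hA.1⟩
  rw [Finset.card_eq_sum_card_fiberwise (fun p hp => hmem p hp),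
    Finset.card_eq_sum_card_fiberwise (fun p hp => hmem p hp)]
  refine Finset.sum_le_sum (fun UW _ => ?_)
  obtain ⟨U, W⟩ := UW
  by_cases hL : ((contractFinset M s e (k + 1) ×ˢ deleteFinset M s k).filter (fun p => f p = (U, W))).card = 0
  · rw [hL]; exact Nat.zero_le _
  obtain ⟨⟨A, B⟩, hAB⟩ := Finset.card_pos.mp (Nat.pos_of_ne_zero hL)
  rw [Finset.mem_filter, Finset.mem_product] at hAB
  obtain ⟨⟨hA, hB⟩, hf⟩ := hAB
  simp only [contractFinset, deleteFinset, Finset.mem_filter, Finset.mem_powerset] at hA hB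
  simp only [hfdef, Prod.mk.injEq] at hf
  obtain ⟨hU, hW⟩ := hf
  have hWU : W ⊆ U := by rw [← hU, ← hW]; exact Finset.inter_subset_left.trans Finset.subset_union_left
  have hWB : W ⊆ B := by rw [← hW]; exact Finset.inter_subset_right
  have hUs : U ⊆ s := by rw [← hU]; exact Finset.union_subset hA.1 hB.1
  have hcardUW : U.card + W.card = A.card + B.card := by
    rw [← hU, ← hW]; exact Finset.card_union_add_card_inter A B
  have hWk : W.card ≤ k := by
    have := Finset.card_le_card hWB; omega
  have hVcard : (U \ W).card = 2 * (k - W.card) + 1 := by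
    rw [Finset.card_sdiff, Finset.inter_eq_left.mpr hWU]; omega
  have hL' := fibre_card_eq M e s U W (k + 1) k (k - W.card + 1) (by omega) (by omega) hWU hUs
  have hR' := fibre_card_eq M e s U W k (k + 1) (k - W.card) (by omega) (by omega) hWU hUs
  simp only [hfdef]
  rw [hL', hR']
  refine h e he ↑W ↑(U \ W) ?_ ?_ ?_ (k - W.card) ?_
  · rw [← hs_coe]; exact Finset.coe_subset.mpr (hWU.trans hUs)
  · rw [← hs_coe]; exact Finset.coe_subset.mpr (Finset.sdiff_subset.trans hUs)
  · rw [Finset.coe_sdiff]; exact Set.disjoint_sdiff_right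
  · rw [Set.ncard_coe_finset, hVcard]

end PercRepro
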